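import Summits.BirchSwinnertonDyer.BirchSwinnertonDyer.Theorems.AlignedTransportAtTwoMainConjectureTransportAlignedAtTwoKilfordCopyCrossLevelHecke
import Literature.NumberTheory.EllipticCurves.ModularJacobianGaloisDataWithForms
import Literature.NumberTheory.EllipticCurves.ModularSymbolsLattice
import HarnessLib

/-!
# Crux C1 `MainConjectureTransportAlignedAtTwo` (stmt-BirchSwinnertonDyer-22296), line `birth`, residual (R2) `stub_lamLawKilford`, UNEQUAL conductors
# `N₂ = N₁q`: THE OLD LINE AS A T1⁺ DATUM — `F₁ = ι₁f₁ + q·ι_qf₁` has rational coefficients and `c₁·Λ_{N₂}(F₁) ⊆ Λ_{E₁}`, so the tree's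
# `ModularParametrizationData.jacobiMapForm D₁ N₂ F₁` (carrier `ModularJacobianGaloisDataWithForms`, T1⁺) is the old-line parametrisation
# `J₀(N₂)(ℂ) → E₁(ℂ)` on the Jacobian; its half-class kernel is the hypothesis currency of `…KilfordCopyCrossLevel`, and it kills `𝔪_{f₂}·Λ_{N₂}`
# (width seat att-p3 g18; `--supports 22296`)

THEOREMS ONLY (no `def`, no `sorry`, no named fact). Plumbing between three tree currencies, nothing else: BSD is not proved by this; C1 is not closed by this.

For `D₁ : ModularParametrizationData W₁ N₁`, `D₂ : ModularParametrizationData W₂ N₂`, `N₂ = N₁q` (`q` prime, `q ∤ N₁`) and the old line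
`F₁ ∈ S₂(Γ₀(N₂))` (`a_n(F₁) = a_n(f₁) + q·a_{n/q}(f₁)`, `…CrossLevelTools.exists_oldLine`):
* `oldLine_cuspCoeff_rational` — `a_n(F₁) ∈ ℚ` (the T1⁺ axiom `jacobiMapForm_galAct` asks for rational `q`-expansion);
* **`oldLine_mul_apply_mem_lattice`** — `c₁·φ(F₁) ∈ Λ_{E₁}` for every `φ ∈ H₁(X₀(N₂);ℤ)` (the well-definedness hypothesis `hg` of `jacobiMapForm`);
* **`jacobiMapForm_oldLine_half_eq_zero_iff`** — `D₁.jacobiMapForm N₂ F₁ _ [φ/2] = O ↔ u₁(c₁·φ(F₁)/2) = O`: the half-class kernel of the old-line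
  parametrisation IS the hypothesis currency `hker`/`hPlane` of `…KilfordCopyCrossLevel.uniformize_depleted_iff_of_oldLine(_conductor)` and
  `…KilfordCopyCrossLevelShapes.sameDepletedKernel_conductorMul_of_oldLinePlane`;
* **`jacobiMapForm_oldLine_half_smul_eq_zero`** — the OLD-LINE HECKE ROW in T1⁺ currency: for `t ∈ 𝔪_{f₂} = F1Sign2.modTwoHeckeIdeal D₂.f` and
  `y ∈ H₁(X₀(N₂);ℤ)`, `D₁.jacobiMapForm N₂ F₁ _ [(t•y)/2] = O` (`…KilfordCopyCrossLevelHecke.oldLine_half_smul_mem` with `Λ₁ = Λ_{E₁}`, `c₁ = D₁.c`,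
  integer coefficients `W₁.LFunction`, `W₂.LFunction`); its ONE parity hypothesis beyond the conductors is `Even (W₁.LFunction q)` (Kraus–Oesterlé).
With these, att-p4 g17's abstract kernel letter `…KilfordKernelLetterOnPoints.ker_iff_ker_of_alignedAtTwo` can be instantiated AT LEVEL `N₂` with
`θ₁` = the old-line parametrisation on `2`-torsion and `θ₂` = `D₂.jacobiMap` on `2`-torsion, the equivariance of `θ₁` being the T1⁺ axiom.

References: Darmon–Diamond–Taylor 1995 §1.7 [DarmonDiamondTaylor1995]; Cremona 1997 §2.4, §2.10 [CremonaAlgorithms1997]; Diamond–Shurman §5.6–§5.7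
[DiamondShurman2005]; Kraus–Oesterlé 1992 Prop. 3 [KrausOesterle1992].
-/

noncomputable section

-- justification: the `Summit.BirchSwinnertonDyer.BirchSwinnertonDyer.…` path repeats a component (route-file convention)
set_option linter.dupNamespace false
set_option autoImplicit false

open scoped MatrixGroups ModularForm Classical

open CongruenceSubgroup Complex WeierstrassCurve
open Literature.NumberTheory.EllipticCurves Literature.NumberTheory.EllipticCurves.ModularForms
open Summit.BirchSwinnertonDyer.Rank1Residual.F1Sign2
open Summit.BirchSwinnertonDyer.BirchSwinnertonDyer.Theorems.AlignedTransportAtTwoKilfordCopyCrossLevelHecke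

namespace Summit.BirchSwinnertonDyer.BirchSwinnertonDyer.Theorems.AlignedTransportAtTwoKilfordCopyCrossLevelOldLineForm

variable {W₁ W₂ : WeierstrassCurve ℚ} {N₁ N₂ : ℕ} [NeZero N₁] {q : ℕ}

/-- **The old line has rational `q`-expansion**: `a_n(F₁) = a_n(W₁) + q·a_{n/q}(W₁) ∈ ℤ`. [cite: DiamondShurman2005, §5.7] -/
theorem oldLine_cuspCoeff_rational (D₁ : ModularParametrizationData W₁ N₁) (F₁ : CuspForm (Gamma0 N₂) 2)
    (hF₁ : ∀ n : ℕ, cuspCoeff F₁ n = cuspCoeff D₁.f n + (q : ℂ) * (if q ∣ n then cuspCoeff D₁.f (n / q) else 0)) :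
    ∀ n : ℕ, ∃ r : ℚ, cuspCoeff F₁ n = (r : ℂ) := by
  intro n
  refine ⟨(W₁.LFunction n + q * (if q ∣ n then W₁.LFunction (n / q) else 0) : ℤ), ?_⟩
  rw [hF₁ n, D₁.isNewformOf.2 n]
  split_ifs with h
  · rw [D₁.isNewformOf.2 (n / q)]; push_cast; ring
  · push_cast; ring

/-- **`c₁·φ(F₁) ∈ Λ_{E₁}` for every cycle `φ ∈ H₁(X₀(N₂);ℤ)`** (`N₁ ∣ N₂`, `N₁q ∣ N₂`): the periods of `F₁ = ι₁f₁ + q·ι_qf₁` are periods of `f₁`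
(`…CrossLevelHecke.mul_apply_oldBasis_mem`) and `c₁Λ_{f₁} ⊆ Λ_{E₁}` (`D₁.smul_periodLattice_le`). This is the hypothesis `hg` of
`ModularParametrizationData.jacobiMapForm D₁ N₂ F₁`. [cite: CremonaAlgorithms1997, §2.4 and §2.10] -/
theorem oldLine_mul_apply_mem_lattice [NeZero N₂] [NeZero q] (D₁ : ModularParametrizationData W₁ N₁) (h₁ : N₁ * 1 ∣ N₂) (hq' : N₁ * q ∣ N₂)
    (F₁ : CuspForm (Gamma0 N₂) 2)
    (hF₁ : ∀ n : ℕ, cuspCoeff F₁ n = cuspCoeff D₁.f n + (q : ℂ) * (if q ∣ n then cuspCoeff D₁.f (n / q) else 0)) :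
    ∀ φ ∈ periodHomology N₂, (D₁.c : ℂ) * φ F₁ ∈ D₁.L.lattice := by
  intro φ hφ
  obtain ⟨i₁, i₂⟩ := mul_apply_oldBasis_mem h₁ hq' D₁.f D₁.L.lattice.toAddSubgroup D₁.c
    (fun z hz ↦ D₁.smul_periodLattice_le z hz) hφ
  rw [oldLine_eq h₁ hq' D₁.f F₁ hF₁, map_add, mul_add]
  exact D₁.L.lattice.add_mem i₁ i₂

/-- **The half-class kernel of the old-line parametrisation IS the hypothesis currency of the cross-level reduction**:
`D₁.jacobiMapForm N₂ F₁ _ [φ/2] = O ↔ u₁(c₁·φ(F₁)/2) = O`. [cite: CremonaAlgorithms1997, §2.10] -/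
theorem jacobiMapForm_oldLine_half_eq_zero_iff [NeZero N₂] (D₁ : ModularParametrizationData W₁ N₁) (F₁ : CuspForm (Gamma0 N₂) 2)
    (hg : ∀ φ ∈ periodHomology N₂, (D₁.c : ℂ) * φ F₁ ∈ D₁.L.lattice) (φ : Module.Dual ℂ (CuspForm (Gamma0 N₂) 2)) :
    D₁.jacobiMapForm N₂ F₁ hg (Submodule.Quotient.mk ((2 : ℂ)⁻¹ • φ)) = 0 ↔ D₁.uniformize ((D₁.c : ℂ) * φ F₁ / 2) = 0 := by
  rw [ModularParametrizationData.jacobiMapForm_mk, LinearMap.smul_apply, smul_eq_mul,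
    show (D₁.c : ℂ) * ((2 : ℂ)⁻¹ * φ F₁) = (D₁.c : ℂ) * φ F₁ / 2 by ring]

/-- **THE OLD-LINE HECKE ROW in T1⁺ currency.** `N₂ = N₁q` (`q` an odd prime, `q ∤ N₁`), `a_q(W₁)` EVEN (the one parity hypothesis: Kraus–Oesterlé 1992
Prop. 3 at `p = 2`), `a_q(W₂)` odd and `a_p(W₁) ≡ a_p(W₂) (mod 2)` at every prime `p ≠ q` (hypotheses; at the conductor levels the first follows from
`N(W₂) = N(W₁)q` and the second from the shared cubic field at good `p` and the reduction types at bad `p`): for every `t ∈ 𝔪_{f₂}` and every cycle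
`y`, the old-line parametrisation kills the half-class `[(t•y)/2]`. [cite: DiamondShurman2005, Prop. 5.6.2] [cite: KrausOesterle1992, Prop. 3 (p. 262–263)] -/
theorem jacobiMapForm_oldLine_half_smul_eq_zero [NeZero N₂] [NeZero q] (D₁ : ModularParametrizationData W₁ N₁) (D₂ : ModularParametrizationData W₂ N₂)
    (hN₂ : N₂ = N₁ * q) (hq : q.Prime) (hqN₁ : ¬ q ∣ N₁) (hqodd : Odd q)
    (hq₁ : Even (W₁.LFunction q)) (hq₂ : Odd (W₂.LFunction q)) (hA : ∀ p : ℕ, p.Prime → p ≠ q → (2 : ℤ) ∣ W₁.LFunction p - W₂.LFunction p)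
    (F₁ : CuspForm (Gamma0 N₂) 2)
    (hF₁ : ∀ n : ℕ, cuspCoeff F₁ n = cuspCoeff D₁.f n + (q : ℂ) * (if q ∣ n then cuspCoeff D₁.f (n / q) else 0))
    (hg : ∀ φ ∈ periodHomology N₂, (D₁.c : ℂ) * φ F₁ ∈ D₁.L.lattice)
    {t : HeckeRing0 N₂ 2} (ht : t ∈ modTwoHeckeIdeal D₂.f) (y : periodHomologyHecke N₂) :
    D₁.jacobiMapForm N₂ F₁ hg (Submodule.Quotient.mk ((2 : ℂ)⁻¹ •
      ((t • y : periodHomologyHecke N₂) : Module.Dual ℂ (CuspForm (Gamma0 N₂) 2)))) = 0 := by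
  rw [jacobiMapForm_oldLine_half_eq_zero_iff, D₁.uniformize_eq_zero_iff]
  have hT₁ : ∀ (p : ℕ) (hp : p.Prime), (haveI : NeZero p := ⟨hp.ne_zero⟩; heckeT (Gamma0 N₁) 2 p D₁.f) = cuspCoeff D₁.f p • D₁.f :=
    fun p hp ↦ by haveI : NeZero p := ⟨hp.ne_zero⟩; exact D₁.isNewformOf.1.heckeT_eq_coeff_smul hp
  have hT₂ : ∀ (p : ℕ) (hp : p.Prime), (haveI : NeZero p := ⟨hp.ne_zero⟩; heckeT (Gamma0 N₂) 2 p D₂.f) = cuspCoeff D₂.f p • D₂.f :=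
    fun p hp ↦ by haveI : NeZero p := ⟨hp.ne_zero⟩; exact D₂.isNewformOf.1.heckeT_eq_coeff_smul hp
  exact oldLine_half_smul_mem hN₂ hq hqN₁ hqodd D₁.f D₂.f (IsNewform0.ne_zero D₂.isNewformOf.1) (fun n ↦ W₁.LFunction n)
    (fun n ↦ W₂.LFunction n) D₁.isNewformOf.2 D₂.isNewformOf.2 hT₁ hT₂ hq₁ hq₂ hA F₁ hF₁ D₁.L.lattice.toAddSubgroup D₁.c
    (fun z hz ↦ D₁.smul_periodLattice_le z hz) ht y

end Summit.BirchSwinnertonDyer.BirchSwinnertonDyer.Theorems.AlignedTransportAtTwoKilfordCopyCrossLevelOldLineForm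

end
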